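import Mathlib
import Summits.CriticalPhenomena.CardyFormulaZ2.Theorems.CardySelfRefinementDefs
import Summits.CriticalPhenomena.CardyFormulaZ2.Theorems.CardySelfRefinementGradientComparabilityStubBoundaryValuesLo
import Summits.CriticalPhenomena.CardyFormulaZ2.Theorems.CardySelfRefinementGradientComparabilityStubPathPointUpper
import HarnessLib

/-!
# Bulk path points have `c` bounded away from `0` and `1`

Crux `stmt-CriticalPhenomena-10269`
(`Summit.CriticalPhenomena.CardyFormulaZ2.Theses.CardySelfRefinement.GradientComparability`), line
`monotone-product-coordinates`, stub `stub_slopeBounds`, registered sub-goal **(C)**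
`bulkPathPoints_cRange`.

## Mathematics

Let `γ` be an admissible RSW path (`PathOK k γ`, `k = 2, 3`) and `δ > 0`.  Test the model with the
one-quad family `F = (unit square)`.

* `c_s ≠ 0` at bulk points `ρ_s ≤ 1 - δ`: by the uniform lower non-degeneracy along the path
  (`stub_pathPoint_lower`: `P_η(γ s) ≥ v₁ > 0` for all `s` and all small `η`) and the boundary value
  `c = 0` (`P_zero_lt_eventually`: `P_η(ρ, 0) < v₁` for all `ρ ∈ [0, 1 - δ']` and all small `η`,
  `δ' = min δ ½`; subcritical coarse shadow, Kesten's theorem), a path point `(ρ_s, 0)` with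
  `ρ_s ≤ 1 - δ` would give `v₁ ≤ P_η(ρ_s, 0) < v₁` at a common small mesh.
* `c_s ≠ 1` everywhere: by the uniform upper non-degeneracy (`stub_pathPoint_upper`:
  `P_η(γ s) ≤ v₂ < 1`) and the boundary value `c = 1` (`P_one_eq_one_eventually`:
  `P_η(ρ, 1) = 1`), a path point `(ρ_s, 1)` would give `1 ≤ v₂ < 1`.
* Compactness: `K = {s | ρ_s ≤ 1 - δ}` is a closed subset of the compact `unitInterval`, `s ↦ c_s`
  is continuous with values in `[0, 1]`, positive on `K` and `< 1` on `K`, so it is bounded below on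
  `K` by some `cl > 0` and above by some `ch < 1` (`IsCompact.exists_forall_le'`, applied to `c_s`
  and to `-c_s`).
-/

noncomputable section

namespace Summit.CriticalPhenomena.CardyFormulaZ2.Theorems.CardySelfRefinement

open scoped Topology
open Filter Set MeasureTheory
open Literature.Probability.LatticeModels Literature.Probability.Percolation
open Literature.Probability.Percolation.QuadCrossing
open Summit.CriticalPhenomena.CardyFormulaZ2.Theses.CardySelfRefinement

/-- **No bulk path point on the floor `c = 0`.**  For an admissible path `γ` and `δ > 0`, every
path point with `ρ_s ≤ 1 - δ` has `c_s ≠ 0`: otherwise the uniform lower bound `P ≥ v₁` along the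
path (`stub_pathPoint_lower`) contradicts `P(ρ, 0) < v₁` for `ρ ≤ 1 - δ` at small mesh
(`P_zero_lt_eventually`), tested on the unit square. -/
theorem pathPoint_snd_ne_zero_of_fst_le {k : ℕ} (hk : k = 2 ∨ k = 3) {γ : unitInterval → ℝ × ℝ}
    (hγ : PathOK k γ) {δ : ℝ} (hδ : 0 < δ) (s : unitInterval) (hs : (γ s).1 ≤ 1 - δ) :
    (γ s).2 ≠ 0 := by
  set F : Fin 1 → Quad (univ : Set ℂ) := fun _ => Quad.unitSquare
  obtain ⟨v₁, η₅, hv₁, hη₅, hlow⟩ := stub_pathPoint_lower k hk γ hγ 1 F one_pos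
  have hδ' : 0 < min δ (1 / 2) := lt_min hδ (by norm_num)
  have hev := P_zero_lt_eventually hk F one_pos hδ' (min_le_right _ _) hv₁
  obtain ⟨η, hηP, hηI⟩ := (hev.and (Ioo_mem_nhdsGT hη₅)).exists
  intro h0
  have hρ : (γ s).1 ∈ Icc (0 : ℝ) (1 - min δ (1 / 2)) :=
    ⟨(hγ.2.2.2.1 s).1.1, by linarith [min_le_left δ (1 / 2)]⟩
  have h1 := hlow η hηI s
  have h2 := hηP (γ s).1 hρ
  rw [h0] at h1
  linarith

/-- **No path point on the ceiling `c = 1`.**  For an admissible path `γ`, every path point has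
`c_s ≠ 1`: otherwise the uniform upper bound `P ≤ v₂ < 1` along the path (`stub_pathPoint_upper`)
contradicts `P(ρ, 1) = 1` at small mesh (`P_one_eq_one_eventually`), tested on the unit square. -/
theorem pathPoint_snd_ne_one {k : ℕ} (hk : k = 2 ∨ k = 3) {γ : unitInterval → ℝ × ℝ}
    (hγ : PathOK k γ) (s : unitInterval) : (γ s).2 ≠ 1 := by
  set F : Fin 1 → Quad (univ : Set ℂ) := fun _ => Quad.unitSquare
  obtain ⟨v₂, η₆, hv₂, hη₆, hup⟩ := stub_pathPoint_upper k hk γ hγ 1 F one_pos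
  have hev := P_one_eq_one_eventually hk 1 F
  obtain ⟨η, hηP, hηI⟩ := (hev.and (Ioo_mem_nhdsGT hη₆)).exists
  intro h1
  have ha := hup η hηI s
  have hb := hηP (γ s).1
  rw [h1, hb] at ha
  linarith

/-- **(C) Bulk path points have `c ∈ [cl, ch] ⊂ (0, 1)`.**  For `k = 2, 3`, an admissible path
`γ` and `δ > 0` there are `0 < cl` and `ch < 1` with `c_s ∈ [cl, ch]` at every path point with
`ρ_s ≤ 1 - δ`: `c_s ≠ 0` there (`pathPoint_snd_ne_zero_of_fst_le`), `c_s ≠ 1` everywhere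
(`pathPoint_snd_ne_one`), `c_s ∈ [0, 1]`, and the continuous `s ↦ c_s` is bounded away from `0`
and `1` on the compact set `{s | ρ_s ≤ 1 - δ}` (`IsCompact.exists_forall_le'`). -/
theorem bulkPathPoints_cRange : ∀ k : ℕ, k = 2 ∨ k = 3 → ∀ γ : unitInterval → ℝ × ℝ, PathOK k γ → ∀ δ : ℝ, 0 < δ → ∃ cl ch : ℝ, 0 < cl ∧ ch < 1 ∧ ∀ s : unitInterval, (γ s).1 ≤ 1 - δ → (γ s).2 ∈ Set.Icc cl ch := by
  intro k hk γ hγ δ hδ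
  set K : Set unitInterval := {s | (γ s).1 ≤ 1 - δ}
  have hcont : Continuous γ := hγ.1
  have hKc : IsCompact K :=
    (isClosed_le (continuous_fst.comp hcont) continuous_const).isCompact
  have hc2 : Continuous fun s => (γ s).2 := continuous_snd.comp hcont
  -- lower bound: `c_s > 0` on `K`
  have hpos : ∀ s ∈ K, (0 : ℝ) < (γ s).2 := fun s hs =>
    lt_of_le_of_ne (hγ.2.2.2.1 s).2.1 (pathPoint_snd_ne_zero_of_fst_le hk hγ hδ s hs).symm
  obtain ⟨cl, hcl, hcl'⟩ := hKc.exists_forall_le' hc2.continuousOn hpos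
  -- upper bound: `c_s < 1` on `K`, i.e. `-1 < -c_s`
  have hlt : ∀ s ∈ K, (-1 : ℝ) < -(γ s).2 := fun s _ =>
    neg_lt_neg (lt_of_le_of_ne (hγ.2.2.2.1 s).2.2 (pathPoint_snd_ne_one hk hγ s))
  have hc2' : Continuous fun s => -(γ s).2 := hc2.neg
  obtain ⟨a, ha, ha'⟩ := hKc.exists_forall_le' hc2'.continuousOn hlt
  exact ⟨cl, -a, hcl, by linarith, fun s hs => ⟨hcl' s hs, by linarith [ha' s hs]⟩⟩

end Summit.CriticalPhenomena.CardyFormulaZ2.Theorems.CardySelfRefinement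

end
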